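import Summits.Parity.GeneralizedHardyLittlewood.Theorems.GreenTaoLevelTwoGITwoCyclicInverseLLLCoeff
import Literature.Algebra.EuclideanLattices.MahlerWeylBasisLemma
import Literature.Algebra.EuclideanLattices.IntegerBases
import Summits.Parity.GeneralizedHardyLittlewood.Theorems.GreenTaoLevelTwoGITwoCyclicInverseBogolyubovBohr
import Mathlib.Data.ZMod.Basic

/-!
# Route `GreenTaoLevelTwo`, crux `GITwo` (stmt-Parity-21275), line `birth`, stub `stub_cyclicInverse`:
# the lattice of a Bohr set and its reduced generators (GT08a arXiv §10, Lemma 50 / Cor. 51)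

Fifty-seventh helper file toward the XL stub `stub_cyclicInverse` (B. Green, T. Tao, *An inverse
theorem for the Gowers `U³(G)` norm*, arXiv:math/0503014, Thm. 68 = PEMS 51 (2008) Thm. 12.8).
Block D14 (arXiv §10): "Let `φ: G → (ℝ/ℤ)^S` be the group homomorphism `φ(x) := (ξ · x)_{ξ∈S}` …
Let `Γ ⊆ ℝ^S` be the lattice `φ(G) + ℤ^S`" (proof of arXiv Lemma 50).  For `G = ℤ/Nℤ` and
frequencies `ξ₀,…,ξ_{d−1}` we use the integer model `M = N·Γ = {m ∈ ℤᵈ : ∃ x, m_l ≡ x ξ_l (N) ∀ l}`,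
a subgroup of `ℤᵈ` containing `N ℤᵈ`; it has a triangular basis (tree: `exists_triangular_basis`,
Cassels I Thm I (A)), hence — by the LLL form of arXiv Lemma 48 landed in `…LLLCoeff`
(`exists_reduced_generators_int`) — linearly independent generators `w₀,…,w_{d−1}` whose
coordinates are controlled: every `m ∈ M` is `∑ cⱼ wⱼ` with `|cⱼ|·‖wⱼ‖ ≤ 2^{d(d+2)} ‖m‖`.  The
group elements `vⱼ ∈ ℤ/Nℤ` with `wⱼ ≡ vⱼ ξ (N)` are the generators of the progression of
arXiv Cor. 51, and the linear independence of the `wⱼ = N·({ξ_l vⱼ})_l` is its "Furthermore".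

* `exists_bohr_lattice_generators` — the statement just described (def-free: the lattice is
  written as the membership predicate `∃ x : ℤ/Nℤ, ∀ l, m_l = x ξ_l`).
* `exists_coords_of_bohr` — consequence for an element `x` of the Bohr set
  `{x : ‖x ξ_l / N‖ < ρ ∀ l}` when some `ξ_{l₀} ≠ 0` and `N` is prime: `x = ∑ⱼ cⱼ vⱼ` with
  `|cⱼ|·‖wⱼ‖ ≤ 2^{d(d+2)} d ρ N`, the `cⱼ` being the coordinates of the vector of nearest lifts
  `(valMinAbs (x ξ_l))_l ∈ M`.

References: [GreenTao2008U3Inverse] arXiv:math/0503014, §10, Lemma 50, Cor. 51.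
-/

noncomputable section

namespace Summit.Parity.GeneralizedHardyLittlewood.GreenTaoLevelTwoGITwoCyclicInverse

open Finset Module Literature.Algebra.EuclideanLattices

/-- **Reduced generators of the lattice of a Bohr set (arXiv Lemma 50 / Cor. 51, lattice part).**
For `N ≥ 1` and frequencies `ξ : Fin d → ℤ/Nℤ` there are integer vectors `w₀,…,w_{d−1} ∈ ℤᵈ`,
linearly independent over `ℝ`, and elements `v₀,…,v_{d−1} ∈ ℤ/Nℤ` with `wⱼ ≡ vⱼ·ξ (mod N)`
coordinatewise, such that every `m ∈ ℤᵈ` with `m ≡ x·ξ (mod N)` for some `x` is `∑ⱼ cⱼ wⱼ`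
(`c ∈ ℤᵈ`) with `|cⱼ| · ‖wⱼ‖ ≤ 2^{d(d+2)} ‖m‖` (Euclidean norms).
[cite: GreenTao2008U3Inverse, §10, Lemma 50 and Cor. 51] -/
theorem exists_bohr_lattice_generators {N : ℕ} [NeZero N] {d : ℕ} (ξ : Fin d → ZMod N) :
    ∃ (w : Fin d → Fin d → ℤ) (v : Fin d → ZMod N),
      LinearIndependent ℝ (⇑(intVecToEuclidean d) ∘ w) ∧
      (∀ j l, ((w j l : ℤ) : ZMod N) = v j * ξ l) ∧
      ∀ m : Fin d → ℤ, (∃ x : ZMod N, ∀ l, ((m l : ℤ) : ZMod N) = x * ξ l) →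
        ∃ c : Fin d → ℤ, m = ∑ j, c j • w j ∧
          ∀ j, |(c j : ℝ)| * ‖intVecToEuclidean d (w j)‖ ≤
            2 ^ (d * (d + 2)) * ‖intVecToEuclidean d m‖ := by
  classical
  -- the lattice `M = {m : ∃ x, m ≡ x ξ (N)}`
  let M : Submodule ℤ (Fin d → ℤ) :=
    { carrier := {m | ∃ x : ZMod N, ∀ l, ((m l : ℤ) : ZMod N) = x * ξ l}
      add_mem' := by
        rintro a b ⟨x, hx⟩ ⟨y, hy⟩
        refine ⟨x + y, fun l => ?_⟩
        simp only [Pi.add_apply, Int.cast_add, hx l, hy l]; ring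
      zero_mem' := ⟨0, fun l => by simp⟩
      smul_mem' := by
        rintro c a ⟨x, hx⟩
        refine ⟨(c : ZMod N) * x, fun l => ?_⟩
        simp only [Pi.smul_apply, smul_eq_mul, Int.cast_mul, hx l]; ring }
  have hM : ∀ m : Fin d → ℤ, m ∈ M ↔ ∃ x : ZMod N, ∀ l, ((m l : ℤ) : ZMod N) = x * ξ l :=
    fun m => Iff.rfl
  have hNpos : (0 : ℤ) < N := by exact_mod_cast Nat.pos_of_ne_zero (NeZero.ne N)
  have hNe : ∀ i, (Pi.single i (N : ℤ) : Fin d → ℤ) ∈ M := by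
    intro i
    refine (hM _).2 ⟨0, fun l => ?_⟩
    rw [Pi.single_apply]
    split_ifs
    · simp
    · simp
  -- a triangular basis `h` of `M`
  obtain ⟨h, hhM, hspan, htri, hdiag, -⟩ := exists_triangular_basis d M N hNpos hNe
  -- `h` is linearly independent over `ℝ`: its matrix is lower triangular with nonzero diagonal
  have hli : LinearIndependent ℝ (⇑(intVecToEuclidean d) ∘ h) := by
    let I : LatticeInstance := ⟨d, Matrix.of h⟩
    have hblock : (Matrix.of h).BlockTriangular OrderDual.toDual := by
      intro i j hij
      have hij' : i < j := OrderDual.toDual_lt_toDual.1 hij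
      rw [Matrix.of_apply]
      exact htri i j hij'
    have hdet : I.IsNonsingular := by
      show (Matrix.of h).det ≠ 0
      rw [Matrix.det_of_lowerTriangular _ hblock]
      exact Finset.prod_ne_zero_iff.2 fun j _ => by
        rw [Matrix.of_apply]; exact (hdiag j).1.ne'
    exact LatticeInstance.linearIndependent_vec hdet
  -- LLL-reduced generators with the same span
  obtain ⟨w, hliw, hspanw, hbound⟩ := exists_reduced_generators_int h hli
  have hspan_le : Submodule.span ℤ (Set.range h) ≤ M :=
    Submodule.span_le.2 (Set.range_subset_iff.2 hhM)
  have hwM : ∀ j, w j ∈ M := fun j =>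
    hspan_le (hspanw ▸ Submodule.subset_span (Set.mem_range_self j))
  choose v hv using fun j => (hM _).1 (hwM j)
  refine ⟨w, v, hliw, hv, fun m hm => ?_⟩
  have hmspan : m ∈ Submodule.span ℤ (Set.range w) := hspanw ▸ hspan m ((hM m).2 hm)
  obtain ⟨c, hc⟩ := (Submodule.mem_span_range_iff_exists_fun ℤ).1 hmspan
  refine ⟨c, hc.symm, fun j => ?_⟩
  have hsum : ∑ i, (c i : ℝ) • intVecToEuclidean d (w i) = intVecToEuclidean d m := by
    rw [← hc, map_sum]
    refine Finset.sum_congr rfl fun i _ => ?_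
    rw [LinearMap.map_smul_of_tower, Int.cast_smul_eq_zsmul]
  have := hbound (fun i => (c i : ℝ)) j
  rwa [hsum] at this

/-- The nearest lift: `‖toAddCircle y‖ = |valMinAbs y| / N` on `ℤ/Nℤ`. [folklore] -/
theorem norm_toAddCircle_eq_abs_valMinAbs {N : ℕ} [NeZero N] (y : ZMod N) :
    ‖ZMod.toAddCircle y‖ = |(y.valMinAbs : ℝ)| / N := by
  rw [norm_toAddCircle_eq_min y]
  congr 1
  rw [← ZMod.valMinAbs_natAbs_eq_min, Nat.cast_natAbs, Int.cast_abs]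

/-- **Coordinates of a Bohr-set element (arXiv Cor. 51).**  Let `N` be prime, `ξ : Fin d → ℤ/Nℤ`
with `ξ l₀ ≠ 0`, and `w, v` as in `exists_bohr_lattice_generators`.  If `‖toAddCircle(x ξ_l)‖ < ρ`
for all `l`, then the vector of nearest lifts `m_l = valMinAbs (x ξ_l)` lies in the lattice, so
`m = ∑ cⱼ wⱼ`, `x = ∑ⱼ cⱼ vⱼ`, and `|cⱼ| · ‖wⱼ‖ ≤ 2^{d(d+2)} · d · ρ · N` for every `j`.
[cite: GreenTao2008U3Inverse, §10, Cor. 51] -/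
theorem exists_coords_of_bohr {N : ℕ} [Fact N.Prime] {d : ℕ} (ξ : Fin d → ZMod N) (l₀ : Fin d)
    (hξ : ξ l₀ ≠ 0) {w : Fin d → Fin d → ℤ} {v : Fin d → ZMod N}
    (hv : ∀ j l, ((w j l : ℤ) : ZMod N) = v j * ξ l)
    (hcoord : ∀ m : Fin d → ℤ, (∃ x : ZMod N, ∀ l, ((m l : ℤ) : ZMod N) = x * ξ l) →
      ∃ c : Fin d → ℤ, m = ∑ j, c j • w j ∧
        ∀ j, |(c j : ℝ)| * ‖intVecToEuclidean d (w j)‖ ≤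
          2 ^ (d * (d + 2)) * ‖intVecToEuclidean d m‖)
    {ρ : ℝ} {x : ZMod N} (hx : ∀ l, ‖ZMod.toAddCircle (x * ξ l)‖ < ρ) :
    ∃ c : Fin d → ℤ, (fun l => (x * ξ l).valMinAbs) = ∑ j, c j • w j ∧ x = ∑ j, (c j : ZMod N) * v j ∧
      ∀ j, |(c j : ℝ)| * ‖intVecToEuclidean d (w j)‖ ≤ 2 ^ (d * (d + 2)) * (d * (ρ * N)) := by
  classical
  have hNpos : (0 : ℝ) < N := by exact_mod_cast (Fact.out : N.Prime).pos
  set m : Fin d → ℤ := fun l => (x * ξ l).valMinAbs with hm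
  have hmM : ∃ y : ZMod N, ∀ l, ((m l : ℤ) : ZMod N) = y * ξ l :=
    ⟨x, fun l => by rw [hm]; exact ZMod.coe_valMinAbs _⟩
  obtain ⟨c, hc, hb⟩ := hcoord m hmM
  -- each coordinate of `m` is `< ρ N` in modulus, so `‖m‖ ≤ d ρ N`
  have hml : ∀ l, |(m l : ℝ)| ≤ ρ * N := by
    intro l
    have h1 := hx l
    rw [norm_toAddCircle_eq_abs_valMinAbs, div_lt_iff₀ hNpos] at h1
    exact h1.le
  have hρN : 0 ≤ ρ * N := (abs_nonneg (m l₀ : ℝ)).trans (hml l₀)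
  have hnorm : ‖intVecToEuclidean d m‖ ≤ d * (ρ * N) := by
    rw [EuclideanSpace.norm_eq]
    have hsq : ∑ l, ‖(intVecToEuclidean d m) l‖ ^ 2 ≤ (d * (ρ * N)) ^ 2 := by
      calc ∑ l, ‖(intVecToEuclidean d m) l‖ ^ 2 ≤ ∑ _l : Fin d, (ρ * N) ^ 2 :=
            Finset.sum_le_sum fun l _ => by
              rw [intVecToEuclidean_apply, Real.norm_eq_abs]
              exact pow_le_pow_left₀ (abs_nonneg _) (hml l) 2
        _ = d * (ρ * N) ^ 2 := by
            rw [Finset.sum_const, Finset.card_univ, Fintype.card_fin, nsmul_eq_mul]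
        _ ≤ (d * (ρ * N)) ^ 2 := by
            have hd : (1 : ℝ) ≤ d := by
              have : 0 < d := Fin.pos l₀
              exact_mod_cast this
            have hd2 : (d : ℝ) ≤ (d : ℝ) ^ 2 := by nlinarith
            calc (d : ℝ) * (ρ * N) ^ 2 ≤ (d : ℝ) ^ 2 * (ρ * N) ^ 2 :=
                  mul_le_mul_of_nonneg_right hd2 (sq_nonneg (ρ * N))
              _ = (d * (ρ * N)) ^ 2 := by ring
    calc Real.sqrt (∑ l, ‖(intVecToEuclidean d m) l‖ ^ 2) ≤ Real.sqrt ((d * (ρ * N)) ^ 2) :=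
          Real.sqrt_le_sqrt hsq
      _ = d * (ρ * N) := Real.sqrt_sq (mul_nonneg (Nat.cast_nonneg _) hρN)
  refine ⟨c, hc, ?_, fun j => (hb j).trans (mul_le_mul_of_nonneg_left hnorm (by positivity))⟩
  -- reduce `m = ∑ cⱼ wⱼ` modulo `N` at the coordinate `l₀` and divide by `ξ l₀`
  have h1 : ((m l₀ : ℤ) : ZMod N) = x * ξ l₀ := by rw [hm]; exact ZMod.coe_valMinAbs _
  have h2 : ((m l₀ : ℤ) : ZMod N) = (∑ j, (c j : ZMod N) * v j) * ξ l₀ := by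
    rw [hc, Finset.sum_apply, Int.cast_sum, Finset.sum_mul]
    refine Finset.sum_congr rfl fun j _ => ?_
    rw [Pi.smul_apply, smul_eq_mul, Int.cast_mul, hv j l₀, mul_assoc]
  have h3 : x * ξ l₀ = (∑ j, (c j : ZMod N) * v j) * ξ l₀ := h1.symm.trans h2
  exact mul_right_cancel₀ hξ h3

end Summit.Parity.GeneralizedHardyLittlewood.GreenTaoLevelTwoGITwoCyclicInverse
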